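import Summits.ValiantsHypothesis.ValiantsHypothesis.Theorems.LacunarySymmetroidMatrixDescartesCensusFlankRowCard
import Summits.ValiantsHypothesis.ValiantsHypothesis.Theorems.LacunarySymmetroidMatrixDescartesCensusFlankRow
import Summits.ValiantsHypothesis.ValiantsHypothesis.Theorems.LacunarySymmetroidMatrixDescartesCensusWindowSupportCard

/-!
# `MatrixDescartes` census — the FLANK / WINDOW rows in SUPPORT FORM (emitter interface for the V = 19 position files)

HONEST FRAMING.  Object-search cell `pub-symmetroid`, route `LacunarySymmetroid`; door-A item
`Theses.LacunarySymmetroid.DoorA26` (stmt-ValiantsHypothesis-19979, `= PosRootLawAt 2 6 19`, OPEN, never asserted).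
Elementary repackaging — nothing new is claimed — of the tree's flank-row theorems (`…CensusFlankRowCard`:
`flank_balance_low_card`, `flank_balance_high_card`; `…CensusFlankRow`: `window_balance_mid`) in the SUPPORT FORM used by
the generated door-A position files (`…CensusNineteen<tag>A<kk>.lean`): for a real polynomial `f` with
`#supp f ≤ #Z₊^{distinct}(f) + 3` and four CONSECUTIVE support exponents `a < b < c < d`,

* `flank_balance_low_support` — pattern `(−,+,−,−)` (`f_a f_b < 0`, `f_b f_c < 0`, `f_c f_d > 0`): at some `x > 0`,
  `|f_b| w_b x^b = |f_a| w_a x^a + |f_c| w_c x^c + |f_d| w_d x^d`;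
* `flank_balance_high_support` — pattern `(+,+,−,+)`: `|f_c| w_c x^c = |f_a| w_a x^a + |f_b| w_b x^b + |f_d| w_d x^d`;
* `window_balance_mid_support` — pattern `(−,+,+,−)`: `|f_a| w_a x^a + |f_d| w_d x^d = |f_b| w_b x^b + |f_c| w_c x^c`;

with the REDUCED window weights `w_t = ∏_{u ∈ supp f, u ∉ {a,b,c,d}} |t − u|` (written with the window factors set to `1`),
plus the two bookkeeping lemmas the emitter needs: `flank_amgm_row` (from a two-term bound `A x^p + C x^r ≤ B x^q` at ONE
point `x > 0` to the log-linear row `(α+β)^{α+β} A^β C^α ≤ α^α β^β B^{α+β}`, `α = q − p`, `β = r − q`, constants supplied as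
numerals) and `prod_ite4_abs_sub_eq_natCast` (the reduced weight as a natural number, so that `decide` evaluates it).
These are engine-3 g15's «window rows» WINL / WINR (both AM–GM shadows of the low / high balance) and the middle-window
DISJUNCTION WINM (`2·max(middle terms) ≥ outer sum`) of the door-A Case-A certificates with `+windows`.  NECESSARY
conditions on hypothetical nineteens only; no bound on `ζ_sym(2,6)`, nothing on `DoorA26` (OPEN), on `MatrixDescartes`
(stmt-ValiantsHypothesis-18050) or on `VP ≠ VNP`.

[folklore] Rolle with multiplicity + weighted AM–GM (the tree's flank rows); support bookkeeping.
-/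

-- `Summit.ValiantsHypothesis.ValiantsHypothesis.…` repeats a component by the D-0017 layout
-- (single-conjunct summit), which the `dupNamespace` linter flags; the name is mandated.
set_option linter.dupNamespace false

namespace Summit.ValiantsHypothesis.ValiantsHypothesis.Theorems.LacunarySymmetroidMatrixDescartes.Census

open Polynomial Finset
open scoped BigOperators Polynomial

/-! ### Bookkeeping: reduced window weights -/

/-- Weight transport for a 4-window: with `e` as in `exists_strictMono_enum_support`, the reduced weight over
`range n` (window indices `i, …, i+3` removed) at index `t` equals the support-form reduced weight at `e t`
(window exponents contribute the factor `1`). [folklore] -/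
theorem weight4_enum_eq {f : ℝ[X]} {e : ℕ → ℕ} (he : StrictMono e)
    (hmem : ∀ t, t < f.support.card → e t ∈ f.support)
    (hsurj : ∀ x ∈ f.support, ∃ t, t < f.support.card ∧ e t = x) (i t : ℕ) :
    (∏ u ∈ (range f.support.card).filter (fun u => u < i ∨ i + 4 ≤ u), |(e t : ℝ) - e u|) =
      ∏ x ∈ f.support, (if x = e i ∨ x = e (i + 1) ∨ x = e (i + 2) ∨ x = e (i + 3) then (1 : ℝ)
        else |(e t : ℝ) - x|) := by
  rw [Finset.prod_filter]
  refine Finset.prod_nbij e (fun u hu => hmem u (mem_range.mp hu)) ?_ ?_ ?_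
  · intro a _ b _ hab; exact he.injective hab
  · intro x hx
    obtain ⟨u, hu, hux⟩ := hsurj x hx
    exact ⟨u, by simp only [coe_range, Set.mem_Iio]; exact hu, hux⟩
  · intro u _
    by_cases hw : u < i ∨ i + 4 ≤ u
    · rw [if_pos hw, if_neg]
      rintro (h | h | h | h) <;> (have := he.injective h; omega)
    · rw [if_neg hw, if_pos]
      rcases (show u = i ∨ u = i + 1 ∨ u = i + 2 ∨ u = i + 3 by omega) with h | h | h | h <;> simp [h]

/-- The reduced window weight `∏_{u ∈ s} (u ∈ window ? 1 : |a − u|)` as a natural number (for `decide`). [folklore] -/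
theorem prod_ite4_abs_sub_eq_natCast (s : Finset ℕ) (a p q r t : ℕ) :
    (∏ u ∈ s, (if u = p ∨ u = q ∨ u = r ∨ u = t then (1 : ℝ) else |(a : ℝ) - (u : ℝ)|))
      = ((∏ u ∈ s, (if u = p ∨ u = q ∨ u = r ∨ u = t then 1 else ((a : ℤ) - (u : ℤ)).natAbs) : ℕ) : ℝ) := by
  rw [Nat.cast_prod]
  refine Finset.prod_congr rfl fun u _ => ?_
  split_ifs
  · simp
  · rw [Nat.cast_natAbs]; push_cast; rfl

/-! ### The three window balances in support form -/

/-- Common bookkeeping: four consecutive support exponents are `e t, e (t+1), e (t+2), e (t+3)` for the increasing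
enumeration `e` of the support, with `t + 4 ≤ #supp f`. [folklore] -/
theorem consecutive4_eq_enum {f : ℝ[X]} {e : ℕ → ℕ} (he : StrictMono e)
    (hmem : ∀ t, t < f.support.card → e t ∈ f.support)
    (hsurj : ∀ x ∈ f.support, ∃ t, t < f.support.card ∧ e t = x)
    {a b c d : ℕ} (ha : a ∈ f.support) (hb : b ∈ f.support) (hc : c ∈ f.support) (hd : d ∈ f.support)
    (hab : a < b) (hbc : b < c) (hcd : c < d)
    (hcons₁ : ∀ u ∈ f.support, ¬ (a < u ∧ u < b)) (hcons₂ : ∀ u ∈ f.support, ¬ (b < u ∧ u < c))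
    (hcons₃ : ∀ u ∈ f.support, ¬ (c < u ∧ u < d)) :
    ∃ t, t + 4 ≤ f.support.card ∧ e t = a ∧ e (t + 1) = b ∧ e (t + 2) = c ∧ e (t + 3) = d := by
  obtain ⟨t, ht, rfl, rfl⟩ := consecutive_eq_enum he hmem hsurj ha hb hab hcons₁
  obtain ⟨t', ht', het', rfl⟩ := consecutive_eq_enum he hmem hsurj hb hc hbc hcons₂
  obtain rfl : t' = t + 1 := he.injective het'
  obtain ⟨t'', ht'', het'', rfl⟩ := consecutive_eq_enum he hmem hsurj hc hd hcd hcons₃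
  obtain rfl : t'' = t + 1 + 1 := he.injective het''
  exact ⟨t, by omega, rfl, rfl, rfl, rfl⟩

/-- **FLANK BALANCE, LOW SIDE, SUPPORT FORM.**  `f ∈ ℝ[X]` with `#supp f ≤ #Z₊^{distinct}(f) + 3`; four consecutive
support exponents `a < b < c < d` with `f_a f_b < 0`, `f_b f_c < 0`, `f_c f_d > 0` (isolated sign at `b`, repetition
`(c, d)`).  Then at some `x > 0` the isolated term balances the other three, with reduced window weights. [folklore] -/
theorem flank_balance_low_support (f : ℝ[X])
    (hZ : f.support.card ≤ (f.roots.toFinset.filter (fun x => 0 < x)).card + 3)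
    {a b c d : ℕ} (ha : a ∈ f.support) (hb : b ∈ f.support) (hc : c ∈ f.support) (hd : d ∈ f.support)
    (hab : a < b) (hbc : b < c) (hcd : c < d)
    (hcons₁ : ∀ u ∈ f.support, ¬ (a < u ∧ u < b)) (hcons₂ : ∀ u ∈ f.support, ¬ (b < u ∧ u < c))
    (hcons₃ : ∀ u ∈ f.support, ¬ (c < u ∧ u < d))
    (h1 : f.coeff a * f.coeff b < 0) (h2 : f.coeff b * f.coeff c < 0) (h3 : 0 < f.coeff c * f.coeff d) :
    ∃ x : ℝ, 0 < x ∧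
      |f.coeff b| * (∏ u ∈ f.support, (if u = a ∨ u = b ∨ u = c ∨ u = d then (1 : ℝ) else |(b : ℝ) - u|)) * x ^ b
        = |f.coeff a| * (∏ u ∈ f.support, (if u = a ∨ u = b ∨ u = c ∨ u = d then (1 : ℝ) else |(a : ℝ) - u|)) * x ^ a
          + |f.coeff c| * (∏ u ∈ f.support, (if u = a ∨ u = b ∨ u = c ∨ u = d then (1 : ℝ) else |(c : ℝ) - u|)) * x ^ c
          + |f.coeff d| * (∏ u ∈ f.support, (if u = a ∨ u = b ∨ u = c ∨ u = d then (1 : ℝ) else |(d : ℝ) - u|)) * x ^ d := by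
  have hf : f ≠ 0 := by rintro rfl; simp at ha
  obtain ⟨e, he, hmem, hsurj, hsum⟩ := exists_strictMono_enum_support f hf
  obtain ⟨t, ht, rfl, rfl, rfl, rfl⟩ := consecutive4_eq_enum he hmem hsurj ha hb hc hd hab hbc hcd hcons₁ hcons₂ hcons₃
  have hZ' : f.support.card - 3 ≤ ((∑ s ∈ range f.support.card, C (f.coeff (e s)) * X ^ (e s) : ℝ[X]).roots.toFinset.filter
      (fun x => 0 < x)).card := by
    rw [← hsum]; omega
  obtain ⟨x, hx, hbal⟩ := flank_balance_low_card ht e he (fun s => f.coeff (e s)) hZ' h1 h2 h3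
  refine ⟨x, hx, ?_⟩
  rw [weight4_enum_eq he hmem hsurj t t, weight4_enum_eq he hmem hsurj t (t + 1),
    weight4_enum_eq he hmem hsurj t (t + 2), weight4_enum_eq he hmem hsurj t (t + 3)] at hbal
  exact hbal

/-- **FLANK BALANCE, HIGH SIDE, SUPPORT FORM.**  Pattern `(+,+,−,+)`: `f_a f_b > 0`, `f_b f_c < 0`, `f_c f_d < 0`
(repetition `(a, b)`, isolated sign at `c`): at some `x > 0`,
`|f_c| w_c x^c = |f_a| w_a x^a + |f_b| w_b x^b + |f_d| w_d x^d`. [folklore] -/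
theorem flank_balance_high_support (f : ℝ[X])
    (hZ : f.support.card ≤ (f.roots.toFinset.filter (fun x => 0 < x)).card + 3)
    {a b c d : ℕ} (ha : a ∈ f.support) (hb : b ∈ f.support) (hc : c ∈ f.support) (hd : d ∈ f.support)
    (hab : a < b) (hbc : b < c) (hcd : c < d)
    (hcons₁ : ∀ u ∈ f.support, ¬ (a < u ∧ u < b)) (hcons₂ : ∀ u ∈ f.support, ¬ (b < u ∧ u < c))
    (hcons₃ : ∀ u ∈ f.support, ¬ (c < u ∧ u < d))
    (h1 : 0 < f.coeff a * f.coeff b) (h2 : f.coeff b * f.coeff c < 0) (h3 : f.coeff c * f.coeff d < 0) :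
    ∃ x : ℝ, 0 < x ∧
      |f.coeff c| * (∏ u ∈ f.support, (if u = a ∨ u = b ∨ u = c ∨ u = d then (1 : ℝ) else |(c : ℝ) - u|)) * x ^ c
        = |f.coeff a| * (∏ u ∈ f.support, (if u = a ∨ u = b ∨ u = c ∨ u = d then (1 : ℝ) else |(a : ℝ) - u|)) * x ^ a
          + |f.coeff b| * (∏ u ∈ f.support, (if u = a ∨ u = b ∨ u = c ∨ u = d then (1 : ℝ) else |(b : ℝ) - u|)) * x ^ b
          + |f.coeff d| * (∏ u ∈ f.support, (if u = a ∨ u = b ∨ u = c ∨ u = d then (1 : ℝ) else |(d : ℝ) - u|)) * x ^ d := by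
  have hf : f ≠ 0 := by rintro rfl; simp at ha
  obtain ⟨e, he, hmem, hsurj, hsum⟩ := exists_strictMono_enum_support f hf
  obtain ⟨t, ht, rfl, rfl, rfl, rfl⟩ := consecutive4_eq_enum he hmem hsurj ha hb hc hd hab hbc hcd hcons₁ hcons₂ hcons₃
  have hZ' : f.support.card - 3 ≤ ((∑ s ∈ range f.support.card, C (f.coeff (e s)) * X ^ (e s) : ℝ[X]).roots.toFinset.filter
      (fun x => 0 < x)).card := by
    rw [← hsum]; omega
  obtain ⟨x, hx, hbal⟩ := flank_balance_high_card ht e he (fun s => f.coeff (e s)) hZ' h1 h2 h3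
  refine ⟨x, hx, ?_⟩
  rw [weight4_enum_eq he hmem hsurj t t, weight4_enum_eq he hmem hsurj t (t + 1),
    weight4_enum_eq he hmem hsurj t (t + 2), weight4_enum_eq he hmem hsurj t (t + 3)] at hbal
  exact hbal

/-- **MIDDLE WINDOW BALANCE, SUPPORT FORM.**  Pattern `(−,+,+,−)`: `f_a f_b < 0`, `f_b f_c > 0`, `f_c f_d < 0`
(the repetition `(b, c)` in the middle): at some `x > 0`,
`|f_a| w_a x^a + |f_d| w_d x^d = |f_b| w_b x^b + |f_c| w_c x^c` — hence `2·max(middle terms) ≥ outer sum`, the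
emitter's two-branch disjunction. [folklore] -/
theorem window_balance_mid_support (f : ℝ[X])
    (hZ : f.support.card ≤ (f.roots.toFinset.filter (fun x => 0 < x)).card + 3)
    {a b c d : ℕ} (ha : a ∈ f.support) (hb : b ∈ f.support) (hc : c ∈ f.support) (hd : d ∈ f.support)
    (hab : a < b) (hbc : b < c) (hcd : c < d)
    (hcons₁ : ∀ u ∈ f.support, ¬ (a < u ∧ u < b)) (hcons₂ : ∀ u ∈ f.support, ¬ (b < u ∧ u < c))
    (hcons₃ : ∀ u ∈ f.support, ¬ (c < u ∧ u < d))
    (h1 : f.coeff a * f.coeff b < 0) (h2 : 0 < f.coeff b * f.coeff c) (h3 : f.coeff c * f.coeff d < 0) :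
    ∃ x : ℝ, 0 < x ∧
      |f.coeff a| * (∏ u ∈ f.support, (if u = a ∨ u = b ∨ u = c ∨ u = d then (1 : ℝ) else |(a : ℝ) - u|)) * x ^ a
          + |f.coeff d| * (∏ u ∈ f.support, (if u = a ∨ u = b ∨ u = c ∨ u = d then (1 : ℝ) else |(d : ℝ) - u|)) * x ^ d
        = |f.coeff b| * (∏ u ∈ f.support, (if u = a ∨ u = b ∨ u = c ∨ u = d then (1 : ℝ) else |(b : ℝ) - u|)) * x ^ b
          + |f.coeff c| * (∏ u ∈ f.support, (if u = a ∨ u = b ∨ u = c ∨ u = d then (1 : ℝ) else |(c : ℝ) - u|)) * x ^ c := by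
  have hf : f ≠ 0 := by rintro rfl; simp at ha
  obtain ⟨e, he, hmem, hsurj, hsum⟩ := exists_strictMono_enum_support f hf
  obtain ⟨t, ht, rfl, rfl, rfl, rfl⟩ := consecutive4_eq_enum he hmem hsurj ha hb hc hd hab hbc hcd hcons₁ hcons₂ hcons₃
  have hZ' : f.support.card - 3 ≤ ((∑ s ∈ range f.support.card, C (f.coeff (e s)) * X ^ (e s) : ℝ[X]).roots.countP
      (fun x => 0 < x)) := by
    have h1' := card_posRoots_le_countP_posRoots (∑ s ∈ range f.support.card, C (f.coeff (e s)) * X ^ (e s) : ℝ[X])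
    rw [← hsum] at h1' ⊢; omega
  obtain ⟨x, hx, hbal⟩ := window_balance_mid ht e he (fun s => f.coeff (e s)) hZ' h1 h2 h3
  refine ⟨x, hx, ?_⟩
  rw [weight4_enum_eq he hmem hsurj t t, weight4_enum_eq he hmem hsurj t (t + 1),
    weight4_enum_eq he hmem hsurj t (t + 2), weight4_enum_eq he hmem hsurj t (t + 3)] at hbal
  exact hbal

/-! ### From a two-term bound at one point to a log-linear row -/

/-- **AM–GM row from a two-term bound.**  If `A x^p + C x^r ≤ B x^q` at ONE `x > 0` (`p < q < r`, `A, C ≥ 0`), then with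
`α = q − p`, `β = r − q`: `(α+β)^{α+β} · A^β · C^α ≤ α^α β^β · B^{α+β}` — the constants are taken as hypotheses so that an
emitter can supply them as numerals. [folklore] -/
theorem flank_amgm_row {p q r α β n : ℕ} (hq : p + α = q) (hr : q + β = r) (hn : α + β = n)
    (hα : 0 < α) (hβ : 0 < β) {L R : ℝ} (hL : ((α : ℝ) + β) ^ n = L) (hR : (α : ℝ) ^ α * (β : ℝ) ^ β = R)
    {A B Cc x : ℝ} (hA : 0 ≤ A) (hC : 0 ≤ Cc) (hx : 0 < x)
    (hle : A * x ^ p + Cc * x ^ r ≤ B * x ^ q) :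
    L * A ^ β * Cc ^ α ≤ R * B ^ n := by
  subst hq hr hn hL hR
  have hxq : 0 < x ^ (p + α) := pow_pos hx _
  have hle' : A * x⁻¹ ^ α + Cc * x ^ β ≤ B := by
    have key : (A * x⁻¹ ^ α + Cc * x ^ β) * x ^ (p + α) = A * x ^ p + Cc * x ^ (p + α + β) := by
      have hxα : x ^ α ≠ 0 := pow_ne_zero _ hx.ne'
      rw [inv_pow, add_mul, pow_add, pow_add, pow_add]
      field_simp
    have : (A * x⁻¹ ^ α + Cc * x ^ β) * x ^ (p + α) ≤ B * x ^ (p + α) := by rw [key]; exact hle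
    exact le_of_mul_le_mul_right this hxq
  have h := row_of_two_term_le hα hβ hA hC hx hle'
  calc ((α : ℝ) + β) ^ (α + β) * A ^ β * Cc ^ α ≤ B ^ (α + β) * (α : ℝ) ^ α * (β : ℝ) ^ β := h
    _ = (α : ℝ) ^ α * (β : ℝ) ^ β * B ^ (α + β) := by ring

end Summit.ValiantsHypothesis.ValiantsHypothesis.Theorems.LacunarySymmetroidMatrixDescartes.Census
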